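import Summits.AtomisticToContinuum.BoseEinsteinCondensation.Theorems.BECInsertionCorrectorStaticResponseToHMinusOneRealForm

/-!
# Route `BECInsertionCorrector`, support item `StaticResponseToHMinusOne`
# (stmt-AtomisticToContinuum-12060) — III: the weak Euler–Lagrange equation and the ground-state
# representation of a nonnegative minimiser

For a measurable weight `W` computing the periodic energy (part I) and a real nonnegative periodic
trial state `Θ` of finite energy MINIMISING `Ψ ↦ ⟨Ψ,HΨ⟩` over periodic trial states (value `E₀`):
(a) `eulerLagrange` — `∫∇|Θ|·∇(ζ|Θ|) + ∫W ζ|Θ|² = E₀ ∫ζ|Θ|²` for real `C¹` lattice-periodic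
Bose-symmetric `ζ` (first variation along `(1+εζ)Θ/‖·‖`);
(b) `gsRepresentation` — `⟨θΘ, H θΘ⟩ = E₀ + ∫|∇θ|²|Θ|²` for normalised `θ|Θ|` (Davies' ground-state
transform in `C¹` form: `|∇(θF)|² = ∇F·∇(θ²F) + |∇θ|²F²` and (a) with `ζ = θ²`).
Zeros of `Θ` and non-measurable pair profiles are allowed (parts I–II). Adapted from the sibling
crux's `…StaticResponseBoundModulationEulerLagrange`.

References: [ReedSimonIV1978] §XIII.1 (Rayleigh–Ritz); [Davies1989] §4.2 Thm 4.2.1.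
-/

noncomputable section

open MeasureTheory Filter Set Metric
open scoped ENNReal NNReal Topology BigOperators

namespace Summit.AtomisticToContinuum.BoseEinsteinCondensation.Theorems.StaticResponseToHMinusOne

open Literature.MathematicalPhysics.QuantumManyBody.BoseGas
open Summit.AtomisticToContinuum.BoseEinsteinCondensation.Cruxes.StaticResponseBound.UvThomsonForceWave
  (contDiff_norm_of_real exists_bound_on_cellN integral_mul_perturb_sq integral_gradDot_perturb
    eq_zero_of_forall_small_quadratic_nonneg gradDot_mul_self_eq)
open Summit.AtomisticToContinuum.BoseEinsteinCondensation.Theorems.StaticResponseBound.Negative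
  (integral_norm_sq_eq_one)

variable {N : ℕ} {L : ℝ}

/-! ### (a) The weak Euler–Lagrange equation of a nonnegative minimiser -/

section EulerLagrange

variable {v : ℝ → ℝ≥0∞} {W : Config N → ℝ≥0∞} {Θ : PeriodicTrialState N L}

/-- **(a) Weak Euler–Lagrange equation from minimality.** Let `W` be a measurable weight computing
the periodic energy, `Θ` a real nonnegative periodic trial state of finite energy MINIMISING
`Ψ ↦ ⟨Ψ,HΨ⟩` over the periodic trial states, `E₀ = ⟨Θ,HΘ⟩`. Then for every real `C¹`
lattice-periodic Bose-symmetric `ζ`, `∫ ∇|Θ|·∇(ζ|Θ|) + ∫ W ζ|Θ|² = E₀ ∫ ζ|Θ|²` (real Bochner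
integrals on the cell): the first variation of the Rayleigh quotient along `ε ↦ (1 + εζ)Θ`
vanishes. [cite: ReedSimonIV1978, §XIII.1 (Rayleigh–Ritz)] -/
theorem eulerLagrange (hW : Measurable W)
    (hEW : ∀ Ψ : PeriodicTrialState N L, periodicEnergy v Ψ =
      ∫⁻ X in cellN N L, kineticDensity Ψ.ψ X + W X * ((‖Ψ.ψ X‖₊ : ℝ≥0∞)) ^ 2)
    (hreal : ∀ X, Θ.ψ X = (‖Θ.ψ X‖ : ℂ)) (hfin : periodicEnergy v Θ ≠ ⊤)
    (hmin : ∀ Ψ : PeriodicTrialState N L, periodicEnergy v Θ ≤ periodicEnergy v Ψ)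
    {ζ : Config N → ℝ} (hζ : ContDiff ℝ 1 ζ) (hζper : IsLatticePeriodic L ζ)
    (hζsymm : ∀ (σ : Equiv.Perm (Fin N)) (X : Config N), ζ (X ∘ σ) = ζ X) :
    (∫ X in cellN N L, gradDot (fun Y => ‖Θ.ψ Y‖) (fun Y => ζ Y * ‖Θ.ψ Y‖) X) +
      (∫ X in cellN N L, (W X).toReal * ζ X * ‖Θ.ψ X‖ ^ 2) =
    (periodicEnergy v Θ).toReal * ∫ X in cellN N L, ζ X * ‖Θ.ψ X‖ ^ 2 := by
  -- notation
  set F : Config N → ℝ := fun X => ‖Θ.ψ X‖ with hFdef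
  set U : Config N → ℝ := fun X => (W X).toReal with hUdef
  set lam : ℝ := (periodicEnergy v Θ).toReal with hlam
  have hfin' : (∫⁻ X in cellN N L, kineticDensity Θ.ψ X + W X * ((‖Θ.ψ X‖₊ : ℝ≥0∞)) ^ 2) ≠ ⊤ := by
    rw [← hEW Θ]; exact hfin
  have hF : ContDiff ℝ 1 F := contDiff_norm_of_real Θ hreal
  have hH : ContDiff ℝ 1 fun Y => ζ Y * F Y := hζ.mul hF
  -- integrability of the potential terms
  obtain ⟨M, hM0, hM⟩ := exists_bound_on_cellN hζ.continuous L
  have hbdd : ∀ (g : Config N → ℝ), Continuous g → (∀ X ∈ cellN N L, |g X| ≤ M ^ 2 + M) →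
      IntegrableOn (fun X => g X * (U X * F X ^ 2)) (cellN N L) := by
    intro g hg hgb
    refine Integrable.bdd_mul (integrableOn_toReal_weight_mul_norm_sq (Θ := Θ) hW hfin')
      hg.aestronglyMeasurable (c := M ^ 2 + M) ?_
    rw [ae_restrict_iff' (measurableSet_cellN N L)]
    exact ae_of_all _ fun X hX => by rw [Real.norm_eq_abs]; exact hgb X hX
  have iU0 : IntegrableOn (fun X => U X * F X ^ 2) (cellN N L) :=
    integrableOn_toReal_weight_mul_norm_sq (Θ := Θ) hW hfin'
  have iU1 : IntegrableOn (fun X => U X * ζ X * F X ^ 2) (cellN N L) := by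
    have h := hbdd ζ hζ.continuous fun X hX => (hM X hX).trans (by nlinarith)
    exact h.congr_fun (fun X _ => by ring) (measurableSet_cellN N L)
  have iU2 : IntegrableOn (fun X => U X * ζ X ^ 2 * F X ^ 2) (cellN N L) := by
    have h := hbdd (fun X => ζ X ^ 2) (hζ.continuous.pow 2) fun X hX => by
      rw [abs_pow]; nlinarith [hM X hX, abs_nonneg (ζ X)]
    exact h.congr_fun (fun X _ => by ring) (measurableSet_cellN N L)
  have i10 : IntegrableOn (fun X => (1 : ℝ) * F X ^ 2) (cellN N L) :=
    integrableOn_cellN (continuous_const.mul (hF.continuous.pow 2)) L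
  have i11 : IntegrableOn (fun X => (1 : ℝ) * ζ X * F X ^ 2) (cellN N L) :=
    integrableOn_cellN ((continuous_const.mul hζ.continuous).mul (hF.continuous.pow 2)) L
  have i12 : IntegrableOn (fun X => (1 : ℝ) * ζ X ^ 2 * F X ^ 2) (cellN N L) :=
    integrableOn_cellN ((continuous_const.mul (hζ.continuous.pow 2)).mul (hF.continuous.pow 2)) L
  -- the value `λ` in real form (`θ ≡ 1`)
  have hΘ1 : ∀ X, Θ.ψ X = (((1 : ℝ) * ‖Θ.ψ X‖ : ℝ) : ℂ) := fun X => by rw [one_mul]; exact hreal X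
  have hlam_eq : lam = (∫ X in cellN N L, gradDot F F X) + ∫ X in cellN N L, U X * F X ^ 2 := by
    rw [hlam, toReal_energy_of_eq_mul hW hEW hreal hfin Θ contDiff_const hΘ1]
    simp only [one_mul, hFdef, hUdef]
  -- normalisation `∫ F² = 1`
  have hnorm : ∫ X in cellN N L, (1 : ℝ) * F X ^ 2 = 1 := by
    simp only [one_mul, hFdef]
    exact integral_norm_sq_eq_one Θ
  -- the admissible perturbations
  obtain ⟨ε₀, hε₀, hpert⟩ := exists_perturbedState hreal hζ hζper hζsymm
  -- the key inequality `λ n(ε) ≤ Q(ε)` for small `ε`, expanded to second order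
  have key : ∀ ε : ℝ, |ε| < ε₀ →
      0 ≤ 2 * ε * (((∫ X in cellN N L, gradDot F (fun Y => ζ Y * F Y) X) +
          (∫ X in cellN N L, U X * ζ X * F X ^ 2)) -
          lam * ∫ X in cellN N L, (1 : ℝ) * ζ X * F X ^ 2) +
        ε ^ 2 * (((∫ X in cellN N L, gradDot (fun Y => ζ Y * F Y) (fun Y => ζ Y * F Y) X) +
          (∫ X in cellN N L, U X * ζ X ^ 2 * F X ^ 2)) -
          lam * ∫ X in cellN N L, (1 : ℝ) * ζ X ^ 2 * F X ^ 2) := by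
    intro ε hε
    obtain ⟨Ψ, c, hc, hΨ⟩ := hpert ε hε
    obtain ⟨hne, hE, -, hn⟩ := energy_perturbedState hW hEW hreal hfin ε hζ (fun _ => (0 : ℝ)) Ψ hΨ
    have hminε : lam ≤ (periodicEnergy v Ψ).toReal := ENNReal.toReal_mono hne (hmin Ψ)
    rw [hE] at hminε
    -- `λ n(ε) ≤ Q(ε)`
    have hnn : 0 ≤ ∫ X in cellN N L, ((1 + ε * ζ X) * ‖Θ.ψ X‖) ^ 2 :=
      integral_nonneg fun X => sq_nonneg _
    have hkey : lam * ∫ X in cellN N L, ((1 + ε * ζ X) * ‖Θ.ψ X‖) ^ 2 ≤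
        (∫ X in cellN N L, gradDot (fun Y => (1 + ε * ζ Y) * ‖Θ.ψ Y‖)
          (fun Y => (1 + ε * ζ Y) * ‖Θ.ψ Y‖) X) +
        ∫ X in cellN N L, (W X).toReal * ((1 + ε * ζ X) * ‖Θ.ψ X‖) ^ 2 := by
      have h1 := mul_le_mul_of_nonneg_right hminε hnn
      calc _ ≤ _ := h1
        _ = _ := by rw [mul_comm (c ^ 2), mul_assoc, hn, mul_one]
    -- expand every term to second order in `ε`
    have e1 : ∫ X in cellN N L, ((1 + ε * ζ X) * ‖Θ.ψ X‖) ^ 2 =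
        (∫ X in cellN N L, (1 : ℝ) * F X ^ 2) + 2 * ε * (∫ X in cellN N L, (1 : ℝ) * ζ X * F X ^ 2) +
          ε ^ 2 * ∫ X in cellN N L, (1 : ℝ) * ζ X ^ 2 * F X ^ 2 := by
      rw [← integral_mul_perturb_sq ε i10 i11 i12]
      simp only [one_mul, hFdef]
    rw [e1, integral_gradDot_perturb hζ hF ε L, integral_mul_perturb_sq ε iU0 iU1 iU2,
      hnorm] at hkey
    rw [hlam_eq] at hkey ⊢
    nlinarith [hkey]
  have hzero := eq_zero_of_forall_small_quadratic_nonneg hε₀ key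
  have h1 : ∫ X in cellN N L, (1 : ℝ) * ζ X * F X ^ 2 = ∫ X in cellN N L, ζ X * F X ^ 2 := by
    simp only [one_mul]
  rw [h1] at hzero
  linarith

end EulerLagrange

/-! ### (b) The ground-state representation from minimality -/

section GroundStateRepresentation

variable {v : ℝ → ℝ≥0∞} {W : Config N → ℝ≥0∞} {Θ : PeriodicTrialState N L}

/-- **(b) Ground-state representation from minimality.** In the setting of `eulerLagrange`
(`Θ ≥ 0` a finite-energy minimiser with value `E₀`), every periodic trial state of the form
`Ψ = θ|Θ|` with `θ` real `C¹` lattice-periodic Bose-symmetric satisfies the EXACT identity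
`⟨Ψ,HΨ⟩ = E₀ + 𝓔_{|Θ|}(θ, θ)`, `𝓔_{|Θ|}(θ,θ) = ∫ |∇θ|²|Θ|² = dirichletFormW L |Θ| θ θ` (Davies'
ground-state transform for `C¹` data: `|∇(θΘ)|² = ∇Θ·∇(θ²Θ) + |∇θ|²Θ²` and (a) with `ζ = θ²`).
[cite: Davies1989, §4.2 Thm 4.2.1 (proof), pp. 109–110] -/
theorem gsRepresentation (hW : Measurable W)
    (hEW : ∀ Ψ : PeriodicTrialState N L, periodicEnergy v Ψ =
      ∫⁻ X in cellN N L, kineticDensity Ψ.ψ X + W X * ((‖Ψ.ψ X‖₊ : ℝ≥0∞)) ^ 2)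
    (hreal : ∀ X, Θ.ψ X = (‖Θ.ψ X‖ : ℂ)) (hfin : periodicEnergy v Θ ≠ ⊤)
    (hmin : ∀ Ψ : PeriodicTrialState N L, periodicEnergy v Θ ≤ periodicEnergy v Ψ)
    (Ψ : PeriodicTrialState N L) {θ : Config N → ℝ} (hθ : ContDiff ℝ 1 θ)
    (hθper : IsLatticePeriodic L θ)
    (hθsymm : ∀ (σ : Equiv.Perm (Fin N)) (X : Config N), θ (X ∘ σ) = θ X)
    (hΨ : ∀ X, Ψ.ψ X = ((θ X * ‖Θ.ψ X‖ : ℝ) : ℂ)) :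
    (periodicEnergy v Ψ).toReal =
      (periodicEnergy v Θ).toReal + dirichletFormW L (fun X => ‖Θ.ψ X‖) θ θ := by
  have hF : ContDiff ℝ 1 (fun X => ‖Θ.ψ X‖) := contDiff_norm_of_real Θ hreal
  -- (a) tested with `ζ = θ²`
  have hζ : ContDiff ℝ 1 fun X => θ X ^ 2 := hθ.pow 2
  have hζper : IsLatticePeriodic L fun X => θ X ^ 2 := fun X i a => by
    show θ _ ^ 2 = θ X ^ 2
    rw [hθper X i a]
  have hζsymm : ∀ (σ : Equiv.Perm (Fin N)) (X : Config N),
      (fun X => θ X ^ 2) (X ∘ σ) = (fun X => θ X ^ 2) X := fun σ X => by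
    simp only [hθsymm σ X]
  have hEL := eulerLagrange hW hEW hreal hfin hmin hζ hζper hζsymm
  have hnorm := integral_norm_sq_eq_one Ψ
  simp_rw [norm_sq_of_eq_mul Θ hΨ] at hnorm
  rw [toReal_energy_of_eq_mul hW hEW hreal hfin Ψ hθ hΨ]
  -- the kinetic identity, integrated
  have hkin : ∫ X in cellN N L, gradDot (fun Y => θ Y * ‖Θ.ψ Y‖) (fun Y => θ Y * ‖Θ.ψ Y‖) X =
      (∫ X in cellN N L, gradDot (fun Y => ‖Θ.ψ Y‖) (fun Y => θ Y ^ 2 * ‖Θ.ψ Y‖) X) +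
        dirichletFormW L (fun X => ‖Θ.ψ X‖) θ θ := by
    unfold dirichletFormW
    rw [← integral_add (integrableOn_cellN (continuous_gradDot hF (hζ.mul hF)) L)
      (integrableOn_gradDot_mul_sq hF.continuous hθ hθ L)]
    refine integral_congr_ae (ae_of_all _ fun X => ?_)
    exact gradDot_mul_self_eq (hθ.differentiable one_ne_zero X) (hF.differentiable one_ne_zero X)
  have hsq : ∀ X, (θ X * ‖Θ.ψ X‖) ^ 2 = θ X ^ 2 * ‖Θ.ψ X‖ ^ 2 := fun X => by ring
  simp_rw [hsq] at hnorm ⊢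
  rw [hnorm, mul_one] at hEL
  rw [hkin]
  have e1 : ∫ X in cellN N L, (W X).toReal * (θ X ^ 2 * ‖Θ.ψ X‖ ^ 2) =
      ∫ X in cellN N L, (W X).toReal * θ X ^ 2 * ‖Θ.ψ X‖ ^ 2 := by
    congr 1 with X; ring
  rw [e1]
  linarith [hEL]

end GroundStateRepresentation

end Summit.AtomisticToContinuum.BoseEinsteinCondensation.Theorems.StaticResponseToHMinusOne

end
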